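import Mathlib
import Literature.Computability.Complexity.RangeAvoidance
import HarnessLib

/-!
# Deterministic polynomial-time range avoidance for `NC⁰₂` maps, for MONOTONE `NC⁰₃` maps, and for
`NC⁰ₜ` maps at stretch `m ≥ cᵗ · n^{(t−1)/2} · log n`

Three printed algorithmic landmarks of the range-avoidance literature, vendored as NAMED FACTS over
the syntax of `Literature.Computability.Complexity.RangeAvoidance` (`LocalMap k n m`, `encode`,
`readOut`, `range`; polynomial time = `IsPolyTime`, i.e. Mathlib `Turing.TM2ComputableInPolyTime`,
as in the summit statement `PneNP`), together with their PROVED corollaries in the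
`LocalAvoidLinearFP` shape consumed by the PneNP frontier-ladder rung F-N1b
(`NC⁰₃-AVOID` at linear stretch; cell pnp-ideate, route `Nc03AvoidResidualCore`):

* `GuruswamiLyuWang2025_thm3` — **`NC⁰₂-AVOID ∈ FP` for `m > n`**
  [cite: GuruswamiLyuWang2025, Thm. 3] (journal version of [cite: GuruswamiLyuWang2022];
  re-proved in [cite: KuntewarSarma2025, Thm. 2]);
* `KuntewarSarma2025_thm8` — **`MONOTONE-NC⁰₃-AVOID ∈ FP` for `m > n`**
  [cite: KuntewarSarma2025, Thm. 8 (Main Theorem), p. 62:6; proof §5.2, p. 62:18].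
* `GuruswamiLyuYuan2025_thm13` — **`NC⁰ₜ-AVOID ∈ FP` at stretch `m ≥ cᵗ · n^{(t−1)/2} · log n`**, every
  `t ≥ 3` (so `m ≥ c³ · n · log n` for `t = 3`, `m ≥ c⁴ · n^{3/2} · log n` for `t = 4`)
  [cite: GuruswamiLyuYuan2025, Thm. 1.3 (thm:poly_algo_for_Avoid, §1.3); proof §6.1] — this one is
  NOT a linear-stretch statement and implies no `LocalAvoidLinearFP`; its proved corollaries below are
  the fixed-`t` instances (`.fixed`, `.nc03`, `.nc04`).

Presentation (why the facts are NOT stronger than print). The sources take as input a multi-output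
circuit `C : {0,1}ⁿ → {0,1}ᵐ`, `m > n`, each of whose output bits depends on at most `k` input bits
([cite: KuntewarSarma2025, §1]: "NC⁰ₖ … each output bit depends on at most k of the input bits";
[cite: GuruswamiLyuWang2025, Thm. 3]: "each output bit depends on only two input bits"), MONOTONE
meaning that every output function is monotone ([cite: KuntewarSarma2025, §2]: "`𝒞-AVOID` … each
output function can be computed by a circuit in class `𝒞`"; Thm. 22: "a monotone circuit with
m > n … there are only a few types of monotone functions that depend on 3 bits"). A `LocalMap k n m`
— output `j` applies the truth table `table j` to the (possibly repeated) positions `vars j` — is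
such a circuit, with MONOTONE output functions whenever its tables are monotone (`IsMonotone`), and
its string code `encode` (tables in binary, positions in unary) is polynomial-time inter-convertible
with the circuit; so each fact below is the printed theorem restricted to this presentation. The
theorems are uniform ("there is a deterministic polynomial time algorithm which, given … outputs"),
whence ONE `IsPolyTime` function for all `n < m` (for [cite: GuruswamiLyuYuan2025, Thm. 1.3]:
one for each locality `t`; the printed algorithm is even uniform in `t`, running in time `n^{O(t)}`,
which for fixed `t` is polynomial in the code length `≥ max(n, m)`; the printed threshold
`cᵗ_avoid · n^{(t−1)/2} · log n` is stated below with the natural logarithm and an existential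
constant `c`, which absorbs the base of the logarithm since `t ≥ 1`; the standing hypothesis
`n < m` of the range-avoidance problem [cite: GuruswamiLyuYuan2025, §1.3: "given a circuit
`C : {0,1}ⁿ → {0,1}ᵐ` with `n < m`"] is kept explicit). NOT vendored: the withdrawn
symmetric-`NC⁰₃` claim of the technical-report version of [cite: KuntewarSarma2025] (ECCC
TR25-034 v1, Thm. 1.8 / Lemma 5.2 — absent from the proceedings), and the sub-exponential algorithm
[cite: GuruswamiLyuYuan2025, Thm. 1.4] (time `2^{n^{1−2ε/(t−3)+o(1)}}` at stretch `m ≥ n^{1+ε}`;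
its `o(1)` exponents have no faithful closed form here).
-/

namespace Literature.Computability.Complexity

open _root_.Computability

namespace LocalMap

variable {k n m : ℕ}

/-- A MONOTONE `k`-local instance: every output's truth table is a monotone Boolean function of its
`k` read bits (pointwise order on `Fin k → Bool`, `false < true`) — the truth-table presentation of
the input class `MONOTONE-NC⁰ₖ` of [cite: KuntewarSarma2025, §1.1 and Thm. 8] (each output function
monotone and dependent on at most `k` input bits; with repeated positions the output still is). -/
def IsMonotone (C : LocalMap k n m) : Prop := ∀ j, Monotone (C.table j)

/-- A monotone instance computes a monotone map `{0,1}ⁿ → {0,1}ᵐ` ("by the property of monotone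
functions", the only feature of the class the reduction to `MAJ₃` uses).
[cite: KuntewarSarma2025, Thm. 22 (proof, p. 62:13)] -/
theorem IsMonotone.monotone_eval {C : LocalMap k n m} (h : C.IsMonotone) : Monotone C.eval :=
  fun _ _ hxy j => h j fun i => hxy (C.vars j i)

end LocalMap

/-- Restricting the instance class only makes linear-stretch avoidance easier: `LocalAvoidLinearFP`
is antitone in the side condition `Q` (the same constant and the same algorithm serve every
sub-class; cf. the definition of `𝒞-AVOID` for restricted classes `𝒞`).
[cite: KuntewarSarma2025, §2 (Preliminaries: 𝒞-AVOID)] -/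
theorem LocalAvoidLinearFP.anti {k : ℕ} {Q Q' : ∀ ⦃n m : ℕ⦄, LocalMap k n m → Prop}
    (hQ : ∀ ⦃n m : ℕ⦄ (I : LocalMap k n m), Q' I → Q I) :
    LocalAvoidLinearFP k Q → LocalAvoidLinearFP k Q' := by
  rintro ⟨C, f, hf, h⟩
  exact ⟨C, f, hf, fun n m I hI hn hm => h n m I (hQ I hI) hn hm⟩

/-- **Guruswami–Lyu–Wang, Theorem 3** (verbatim): "There is a polynomial time algorithm which, given
an NC⁰₂ circuit `C : {0,1}ⁿ → {0,1}ᵐ` where `m > n`, outputs a string `y ∈ {0,1}ᵐ` that is not in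
the range of `C`." (Proof idea, loc. cit.: the first output can always be fixed to a constant,
reducing to an instance with fewer inputs; recurse.) Truth-table presentation: ONE polynomial-time
string function which, on the code of any 2-local map with `n < m`, returns in its first `m` bits
a point outside the range. [cite: GuruswamiLyuWang2025, Thm. 3 (§1.1.2)]
[cite: KuntewarSarma2025, Thm. 2 (p. 62:3)] -/
def GuruswamiLyuWang2025_thm3 : Prop :=
  ∃ f : List Bool → List Bool, IsPolyTime f ∧
    ∀ n m (I : LocalMap 2 n m), n < m → readOut m (f I.encode) ∉ I.range

/-- Corollary (ladder shape): `NC⁰₂-AVOID` restricted to ANY sub-class `Q`, at linear stretch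
`m ≥ 2n` (so `m > n` once `n ≥ 1`), is in FP. [cite: GuruswamiLyuWang2025, Thm. 3] -/
theorem GuruswamiLyuWang2025_thm3.localAvoidLinearFP (h : GuruswamiLyuWang2025_thm3)
    (Q : ∀ ⦃n m : ℕ⦄, LocalMap 2 n m → Prop) : LocalAvoidLinearFP 2 Q := by
  obtain ⟨f, hf, h⟩ := h
  exact ⟨2, f, hf, fun n m I _ hn hm => h n m I (by omega)⟩

/-- **Kuntewar–Sarma, Theorem 8 (Main Theorem)** (verbatim): "For `m > n`, MONOTONE-NC⁰₃-AVOID can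
be solved in deterministic polynomial time." (Proof, loc. cit. §4.1 Thm. 22 + §5: reduce to `MAJ₃`
outputs by fixing every other monotone 3-bit output type, cluster to `|I(K)| < |K|`, reduce
two-intersecting pairs, then find a loose `X_{2ℓ}` cycle — which exists in every connected linear
3-uniform hypergraph with more edges than vertices, Thm. 7 — and colour it against `MAJ`.)
Truth-table presentation: ONE polynomial-time string function which, on the code of any 3-local map
with MONOTONE tables and `n < m`, returns in its first `m` bits a point outside the range.
[cite: KuntewarSarma2025, Thm. 8 (Main Theorem, p. 62:6; proof p. 62:18)]

ERRATUM NOTE (status of the printed proof; the STATEMENT is vendored unchanged and remains a cited,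
undischarged hypothesis — nothing in this tree uses it unconditionally). The published proof of Thm. 8
passes from Thm. 7 (every connected linear 3-uniform hypergraph with more hyperedges than vertices
contains a LOOSE `X_{2ℓ}` cycle, i.e. one built from Berge WALKS with repeated edges/vertices allowed,
Def. p. 62:7) to Cor. 17 (a SUB-HYPERGRAPH with an edge-colouring that is not a `MAJ`-colouring) through
the one-sentence Cor. 27 (p. 62:18: "the edge-coloring demonstrated in the proof of Lemma 26 is also an
edge-coloring of loose `X_{2ℓ}`-cycle which is not a MAJ-coloring"), which is stated without proof and
fails for the walks Thm. 7's proof produces: Lemma 26 colours hyperedges by the PARITY OF THEIR POSITION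
along the cycle, and in the walk `g P′ f″ Q f″ P′ g P g′` of Thm. 7's proof (with `Q` an odd cycle inside
one clique of the block graph, i.e. three hyperedges through one common variable) the hyperedge `f″` and
every hyperedge of `P′` recur at positions of opposite parity, so the positional colouring is not a
function on the edge set of the visited sub-hypergraph, and the `MAJ`-forcing of Lemma 26 does not
propagate through the same-vertex turns of `Q`. The identical sentence appears in the arXiv version
(arXiv:2503.17114, §5, before the proof of the Main Theorem). The gap was found in this project
(2026-08-26) and is recorded with verbatim locators in the cell record
`run/shared/lean/pub/pnp-ideate/pnp-ideate-ref/FACTCHECK-KS25-thm8-gap.md`; the claim is not withdrawn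
by the authors and may be true, but it must not be cited as an ESTABLISHED theorem — only as the
hypothesis `KuntewarSarma2025_thm8` below (its two corollaries here take it as an explicit argument).
[cite: KuntewarSarma2025, Cor. 27 (p. 62:18), Thm. 7 (p. 62:17–18), Lemma 26 (p. 62:18), Cor. 17
(p. 62:11); arXiv:2503.17114 §5] -/
def KuntewarSarma2025_thm8 : Prop :=
  ∃ f : List Bool → List Bool, IsPolyTime f ∧
    ∀ n m (I : LocalMap 3 n m), I.IsMonotone → n < m → readOut m (f I.encode) ∉ I.range

/-- Corollary (ladder shape): `NC⁰₃-AVOID` restricted to any class `Q` of MONOTONE instances, at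
linear stretch `m ≥ 2n`, is in FP — e.g. the pure `AND₃`, `MAJ₃`, `a ∧ (b ∨ c)` classes of the
predicate-by-predicate analysis. [cite: KuntewarSarma2025, Thm. 8] -/
theorem KuntewarSarma2025_thm8.localAvoidLinearFP (h : KuntewarSarma2025_thm8)
    {Q : ∀ ⦃n m : ℕ⦄, LocalMap 3 n m → Prop}
    (hQ : ∀ ⦃n m : ℕ⦄ (I : LocalMap 3 n m), Q I → I.IsMonotone) : LocalAvoidLinearFP 3 Q := by
  obtain ⟨f, hf, h⟩ := h
  exact ⟨2, f, hf, fun n m I hI hn hm => h n m I (hQ I hI) (by omega)⟩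

/-- In particular the PURE `MAJ₃` class (`IsPure` of the 3-bit majority) is solved at linear
stretch, given Theorem 8. [cite: KuntewarSarma2025, Thm. 8 and Thm. 22] -/
theorem KuntewarSarma2025_thm8.maj₃ (h : KuntewarSarma2025_thm8) :
    LocalAvoidLinearFP 3 (fun _ _ I =>
      I.IsPure fun u => (u 0 && u 1) || (u 0 && u 2) || (u 1 && u 2)) := by
  refine h.localAvoidLinearFP fun n m I hI j => ?_
  rw [hI.1 j]
  intro u v huv
  simp only [Bool.le_iff_imp, Bool.or_eq_true, Bool.and_eq_true]
  have h0 := huv 0; have h1 := huv 1; have h2 := huv 2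
  simp only [Bool.le_iff_imp] at h0 h1 h2
  tauto

/-- **Guruswami–Lyu–Yuan, Theorem 1.3** (verbatim): "There is a universal constant `c_avoid` such
that the following holds. There is a deterministic algorithm which, given `t ≥ 3` and an `NC⁰ₜ`
circuit `C : {0,1}ⁿ → {0,1}ᵐ` as input, outputs some `y ∈ {0,1}ᵐ ∖ Range(C)` in time `n^{O(t)}`
whenever `m ≥ c_avoidᵗ · n^{(t−1)/2} · log n`." (Proof, loc. cit. §6.1: if `≥ n+1` outputs are
XOR/NXOR, Gaussian elimination; otherwise enumerate the polynomially many strings `b` in the range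
of an explicit small-bias generator and certify `b ∉ Range(C)` by summing the polynomial-time
refutation bounds of the weighted `|α|`-XOR instances `ψ_{ℋ_α, b ⊙ ĝ_α}`, `α ⊊ [t]`, against
`1 − 2^{1−t}`; a constant fraction of the `b` pass.) Truth-table presentation: ONE universal
constant `c` and, for every locality `t ≥ 3`, ONE polynomial-time string function which, on the
code of any `t`-local map with `n < m` and `cᵗ · n^{(t−1)/2} · log n ≤ m`, returns in its first
`m` bits a point outside the range (per-`t` solver and natural logarithm: both at most as strong
as print, see the module docstring).
[cite: GuruswamiLyuYuan2025, Thm. 1.3 (§1.3, thm:poly_algo_for_Avoid); proof §6.1] -/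
def GuruswamiLyuYuan2025_thm13 : Prop :=
  ∃ c : ℕ, ∀ t : ℕ, 3 ≤ t → ∃ f : List Bool → List Bool, IsPolyTime f ∧
    ∀ n m (I : LocalMap t n m), n < m →
      (c : ℝ) ^ t * (n : ℝ) ^ (((t : ℝ) - 1) / 2) * Real.log n ≤ m →
        readOut m (f I.encode) ∉ I.range

/-- Corollary (fixed locality): for each `t ≥ 3` there are a constant `c'` (namely `cᵗ`) and ONE
polynomial-time function solving `NC⁰ₜ-AVOID` on every instance with `n < m` and
`c' · n^{(t−1)/2} · log n ≤ m`. [cite: GuruswamiLyuYuan2025, Thm. 1.3] -/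
theorem GuruswamiLyuYuan2025_thm13.fixed (h : GuruswamiLyuYuan2025_thm13) {t : ℕ} (ht : 3 ≤ t) :
    ∃ c' : ℕ, ∃ f : List Bool → List Bool, IsPolyTime f ∧
      ∀ n m (I : LocalMap t n m), n < m →
        (c' : ℝ) * (n : ℝ) ^ (((t : ℝ) - 1) / 2) * Real.log n ≤ m →
          readOut m (f I.encode) ∉ I.range := by
  obtain ⟨c, hc⟩ := h
  obtain ⟨f, hf, hsolve⟩ := hc t ht
  refine ⟨c ^ t, f, hf, fun n m I hnm hm => hsolve n m I hnm ?_⟩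
  simpa [Nat.cast_pow] using hm

/-- Corollary (`t = 3`): `NC⁰₃-AVOID ∈ FP` at stretch `m ≥ c' · n · log n` — the regime just above
the linear stretch `m = Θ(n)` of `LocalAvoidLinearFP 3` (which is NOT implied).
[cite: GuruswamiLyuYuan2025, Thm. 1.3 (t = 3)] -/
theorem GuruswamiLyuYuan2025_thm13.nc03 (h : GuruswamiLyuYuan2025_thm13) :
    ∃ c' : ℕ, ∃ f : List Bool → List Bool, IsPolyTime f ∧
      ∀ n m (I : LocalMap 3 n m), n < m →
        (c' : ℝ) * (n : ℝ) * Real.log n ≤ m → readOut m (f I.encode) ∉ I.range := by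
  obtain ⟨c', f, hf, hsolve⟩ := h.fixed (t := 3) le_rfl
  refine ⟨c', f, hf, fun n m I hnm hm => hsolve n m I hnm ?_⟩
  have h1 : ((((3 : ℕ) : ℝ) - 1) / 2) = (1 : ℝ) := by norm_num
  rw [h1, Real.rpow_one]
  exact hm

/-- Corollary (`t = 4`): `NC⁰₄-AVOID ∈ FP` at stretch `m ≥ c' · n^{3/2} · log n` (the instance
consumed by the PneNP frontier-ladder rung F-N1b for the star-structured `IP₂` quotient maps,
cell pnp-ideate, ROUND-3-ADDENDUM-D Cor. D.10). [cite: GuruswamiLyuYuan2025, Thm. 1.3 (t = 4)] -/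
theorem GuruswamiLyuYuan2025_thm13.nc04 (h : GuruswamiLyuYuan2025_thm13) :
    ∃ c' : ℕ, ∃ f : List Bool → List Bool, IsPolyTime f ∧
      ∀ n m (I : LocalMap 4 n m), n < m →
        (c' : ℝ) * (n : ℝ) ^ ((3 : ℝ) / 2) * Real.log n ≤ m → readOut m (f I.encode) ∉ I.range := by
  obtain ⟨c', f, hf, hsolve⟩ := h.fixed (t := 4) (by norm_num)
  refine ⟨c', f, hf, fun n m I hnm hm => hsolve n m I hnm ?_⟩
  have h1 : ((((4 : ℕ) : ℝ) - 1) / 2) = ((3 : ℝ) / 2) := by norm_num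
  rw [h1]
  exact hm

end Literature.Computability.Complexity
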